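/- Fleet lead `ym-wcr-19456-p1`, route `WeakCouplingRates`, crux `ColdBoxTwoPointFloorW` (stmt-QuantumFields-19608). -/
import Summits.QuantumFields.YangMills.Theorems.WeakCouplingRatesColdBoxLargeFieldSU2
import Summits.QuantumFields.YangMills.Theorems.WeakCouplingRatesColdBoxGoodEvent
import Summits.QuantumFields.YangMills.Theorems.WeakCouplingRatesBulkDominatesColdBoxWDlrPlumbing
import Literature.MathematicalPhysics.QuantumLattice.LatticeGaugeDLRGibbsProofs

/-!
# Cold box: reduction of `boxPlaqCov` to the small-field conditioned state

Line `birth` of crux `ColdBoxTwoPointFloorW` (stmt-QuantumFields-19608), step (c), part 1 of the lead's plan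
(`pub/ym-fleet/ym-wcr-19456-p1/PLAN-S3c-ii.md`): for `0 < θ`, `2θ < ε` and `H = ⌈β^θ⌉`, the connected two-point function
`boxPlaqCov ρ β H T` of the two central plaquette costs under the cold-wall box state `boxState ρ β H` (`ρ` = fundamental `SU(2)`)
differs from the same connected two-point function under the box state CONDITIONED on the small-field event
`coldGoodSet β ε H` (every plaquette touching the box costs `< β^{2ε−1}`) by at most `96·exp(−β^ε)`, eventually in `β`
(`abs_boxPlaqCov_sub_cond_le`).  Ingredients: `abs_cov_sub_cov_cond_le` (`|Cov_μ − Cov_{μ[|G]}| ≤ 6·M_f·M_g·μ(Gᶜ)` with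
`M_f = M_g = 4`, the bound `abs_plaqCostAt_le` of the sibling line `dlr-chessboard`) and `boxState_largeField_rarity`
(`μ(Gᶜ) ≤ exp(−β^ε)`).
-/

set_option autoImplicit false

noncomputable section

open MeasureTheory ProbabilityTheory
open Literature.MathematicalPhysics.QuantumLattice
open Literature.MathematicalPhysics.QuantumFieldTheory

namespace Summit.QuantumFields.YangMills.Theorems.WeakCouplingRates

/-- **The small-field (good) event** of the cold box at scale `β^{2ε−1}`: every plaquette touching `Λ = boxEdges 4 (2H+1)` costs
`< β^{2ε−1}`.  Its complement is the large-field event of `boxState_largeField_rarity`. -/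
def coldGoodSet (β ε : ℝ) (H : ℕ) : Set (LGConfig 4 (Matrix.specialUnitaryGroup (Fin 2) ℂ)) :=
  {U | ∃ p ∈ plaquettesTouching (AxialGauge.boxEdges 4 (2 * H + 1)),
      β ^ (2 * ε - 1) ≤ (2 : ℝ) - plaquetteObs (fundamentalRep (Fin 2)) p.1 p.2.1.1 p.2.1.2 U}ᶜ

/-- The good event is measurable. -/
theorem measurableSet_coldGoodSet (β ε : ℝ) (H : ℕ) : MeasurableSet (coldGoodSet β ε H) :=
  (measurableSet_exists_plaqCost_ge _ _).compl

/-- **Step (c), part 1: conditioning the cold box on small fields costs `96·e^{−β^ε}`.**  For `0 < θ`, `ε > 2θ`, eventually in `β`,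
the connected two-point function `boxPlaqCov` of the two central plaquette costs under `boxState` differs from the same connected
two-point function under `boxState` CONDITIONED on the small-field event `coldGoodSet β ε ⌈β^θ⌉` by at most `96·exp(−β^ε)`
(`abs_cov_sub_cov_cond_le` with `|cost| ≤ 4` and `boxState_largeField_rarity`). -/
theorem abs_boxPlaqCov_sub_cond_le {θ ε : ℝ} (hθ : 0 < θ) (hε : 2 * θ < ε) :
    ∃ β₀ : ℝ, ∀ β : ℝ, β₀ ≤ β → ∀ T : ℕ,
      |boxPlaqCov (fundamentalRep (Fin 2)) β ⌈β ^ θ⌉₊ T -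
        ((∫ U, plaqCostAt (fundamentalRep (Fin 2)) (boxCentre ⌈β ^ θ⌉₊) 1 2 U *
              plaqCostAt (fundamentalRep (Fin 2)) (boxCentre ⌈β ^ θ⌉₊ + Pi.single 0 (T : ℤ)) 1 2 U
            ∂((boxState (fundamentalRep (Fin 2)) β ⌈β ^ θ⌉₊)[|coldGoodSet β ε ⌈β ^ θ⌉₊])) -
          (∫ U, plaqCostAt (fundamentalRep (Fin 2)) (boxCentre ⌈β ^ θ⌉₊) 1 2 U
            ∂((boxState (fundamentalRep (Fin 2)) β ⌈β ^ θ⌉₊)[|coldGoodSet β ε ⌈β ^ θ⌉₊])) *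
          (∫ U, plaqCostAt (fundamentalRep (Fin 2)) (boxCentre ⌈β ^ θ⌉₊ + Pi.single 0 (T : ℤ)) 1 2 U
            ∂((boxState (fundamentalRep (Fin 2)) β ⌈β ^ θ⌉₊)[|coldGoodSet β ε ⌈β ^ θ⌉₊])))| ≤
        96 * Real.exp (-(β ^ ε)) := by
  haveI := secondCountableTopology_SU2
  obtain ⟨β₀, hβ₀⟩ := boxState_largeField_rarity hθ hε
  refine ⟨max β₀ 1, fun β hβ T => ?_⟩
  have hb0 : β₀ ≤ β := (le_max_left _ _).trans hβ
  have hβ1 : 1 ≤ β := (le_max_right _ _).trans hβ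
  set H := ⌈β ^ θ⌉₊ with hH
  set μ := boxState (fundamentalRep (Fin 2)) β H with hμ
  haveI : IsProbabilityMeasure μ := by
    rw [hμ]; exact isProbabilityMeasure_ymSpecification _ (continuous_fundamentalRep (Fin 2)) β _ _
  set G := coldGoodSet β ε H with hG
  have hGm : MeasurableSet G := measurableSet_coldGoodSet β ε H
  have hbad : μ.real Gᶜ ≤ Real.exp (-(β ^ ε)) := by
    have := hβ₀ β hb0
    rw [hG, coldGoodSet, compl_compl]; exact this
  have hbad1 : μ.real Gᶜ < 1 := lt_of_le_of_lt hbad (by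
    rw [Real.exp_lt_one_iff]
    have : 0 < β ^ ε := Real.rpow_pos_of_pos (by linarith) ε
    linarith)
  have hG0 : μ G ≠ 0 := by
    intro h0
    have h1 : μ.real G = 0 := by rw [measureReal_def, h0, ENNReal.toReal_zero]
    have h2 : μ.real G + μ.real Gᶜ = 1 := by rw [measureReal_add_measureReal_compl hGm, probReal_univ]
    linarith
  set f := plaqCostAt (d := 4) (fundamentalRep (Fin 2)) (boxCentre H) 1 2 with hf
  set g := plaqCostAt (d := 4) (fundamentalRep (Fin 2)) (boxCentre H + Pi.single 0 (T : ℤ)) 1 2 with hg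
  have hfm : Measurable f := measurable_plaqCostAt _ _ _
  have hgm : Measurable g := measurable_plaqCostAt _ _ _
  have hfi : Integrable f μ := integrable_of_bound hfm.aestronglyMeasurable (abs_plaqCostAt_le _ _ _)
  have hgi : Integrable g μ := integrable_of_bound hgm.aestronglyMeasurable (abs_plaqCostAt_le _ _ _)
  have hfgi : Integrable (fun U => f U * g U) μ := integrable_of_bound (hfm.mul hgm).aestronglyMeasurable (C := 4 * 4)
    (fun U => by rw [abs_mul]; exact mul_le_mul (abs_plaqCostAt_le _ _ _ U) (abs_plaqCostAt_le _ _ _ U) (abs_nonneg _) (by norm_num))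
  have key := abs_cov_sub_cov_cond_le (μ := μ) hGm hG0 hfi hgi hfgi (abs_plaqCostAt_le _ _ _) (abs_plaqCostAt_le _ _ _)
  have hcov : boxPlaqCov (fundamentalRep (Fin 2)) β H T = (∫ U, f U * g U ∂μ) - (∫ U, f U ∂μ) * (∫ U, g U ∂μ) := rfl
  rw [hcov]
  calc _ ≤ 6 * 4 * 4 * μ.real Gᶜ := key
    _ ≤ 96 * Real.exp (-(β ^ ε)) := by nlinarith [hbad, measureReal_nonneg (μ := μ) (s := Gᶜ)]

end Summit.QuantumFields.YangMills.Theorems.WeakCouplingRates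

end
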